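import Mathlib.Data.ZMod.QuotientRing
import Mathlib.Data.Nat.Periodic
import Mathlib.Data.Nat.Count
import Mathlib.Analysis.SpecialFunctions.Pow.Asymptotics
import Mathlib.Analysis.PSeries
import Mathlib.Topology.Algebra.InfiniteSum.Real
import Literature.NumberTheory.Sieve.BrunPureSieve
import Literature.NumberTheory.Sieve.SingularSeries
import Literature.NumberTheory.LFunctions.MertensElementary
import Literature.NumberTheory.Sieve.AsymptoticSieveForPrimesDecompositionProofs
import HarnessLib

/-!
# Brun's theorem: the sum of the reciprocals of the twin primes converges

Trunk T-SIEVE (`Literature/NumberTheory/Sieve`). A complete proof of Brun's theorem (1919),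
written to discharge the named fact `Literature.NumberTheory.Sieve.summable_one_div_twin_primes` (**parity.S20**,
`Literature/NumberTheory/Sieve/ParityWave0.lean`; the discharge itself is the one-liner
`Literature.NumberTheory.Sieve.summable_one_div_twin_primes_holds` in `ParityWave0Proofs.lean`). Everything here is
PROVED (no named facts are assumed).

## The argument (Cojocaru–Murty, Thm 5.4.4 and Cor 5.4.5, via the pure sieve of §6.1)

Sift `𝒜 = {1 ≤ n ≤ N}` by the odd primes `p < z`, removing `n` with `p ∣ n(n+2)` (the classes
`0, -2 mod p`). Twin primes `z ≤ p ≤ N` survive, so `π₂(N) ≤ z + S(𝒜, z)`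
(`twin_count_le_add_card_sifted`).

* Local densities (`abs_card_filter_twin_sub_le`): for a set `S` of odd primes,
  `#{n ≤ N : p ∣ n(n+2) ∀ p ∈ S} = N ∏_{p ∈ S} 2/p + θ`, `|θ| ≤ 2^{#S}` — by the Chinese remainder
  theorem (`ZMod.prodEquivPi`; `card_filter_range_prod_eq_two_pow`: exactly `2^{#S}` residues modulo
  `∏ S`) and periodicity (`abs_card_filter_Icc_sub_le`).
* Brun's pure sieve (`twin_pure_sieve_le`), from the abstract Bonferroni inequalities of
  `Literature/NumberTheory/Sieve/BrunPureSieve.lean` (Cojocaru–Murty §6.1 (6.1)–(6.5)): for even `r`,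
  `S(𝒜, z) ≤ N (∏_{2<p<z} (1 - 2/p) + e_{r+1}) + 2^r ∑_{k ≤ r} C(π(z), k)`, `e_{r+1}` the
  `(r+1)`-st elementary symmetric function of the `2/p`.
* Inputs: `∏_{2<p<z}(1 - 2/p) ≤ 4/(log z)²` (`prod_one_sub_two_div_le`, from the tree's
  Mertens-free `Literature.NumberTheory.Sieve.log_le_prod_primesBelow_one_sub_inv_inv`: `log z ≤ ∏_{p<z}(1 - 1/p)⁻¹`);
  `∑_{p<z} 2/p ≤ 2(log log z + 4)` (`sum_two_div_le`, from `Literature.NumberTheory.LFunctions.MertensBound.sum_inv_prime_le`);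
  Rankin's bound `e_k ≤ 8^{-k} exp(8 ∑ 2/p) ≤ exp(-2k + 16 (log log z + 4))` (`esymm_two_div_le`).
* Parameters (`twin_count_le_of_conditions`): `L = log N`, `ℓ = log L`, `log z = L/(84 ℓ)`,
  `r = 2(⌈5ℓ⌉ + 15)`: main term `≤ 4·84² N ℓ²/L²`, tail `≤ N/L²`, binomial remainder
  `(2z)^r ≤ exp(59 ℓ + L/2) ≤ N/L²`, and `z ≤ N/L²`, whence **`π₂(N) ≤ 28227 N ℓ²/L²`** under four
  explicit growth conditions, which hold for large `N` (`eventually_conditions`: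
  `(log x)^{61} = o(x^{1/2})`, `log L = o(L)`). This is `eventually_twin_count_le` /
  `twin_count_isBigO` (Cojocaru–Murty Thm 5.4.4 with an explicit constant) and the handier
  `exists_twin_count_le_div_rpow` (`π₂(N) ≤ C N/(log N)^{3/2}`).
* Brun's theorem (`summable_indicator_one_div_twin`, `summable_one_div_twin_prime`): dyadic blocks
  `∑_{2^j ≤ p < 2^{j+1}} 1/p ≤ π₂(2^{j+1})/2^j ≪ (j+1)^{-3/2}` and `summable_of_sum_range_le`
  (Cojocaru–Murty Cor 5.4.5 uses partial summation instead).

## References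

* V. Brun, *La série 1/5+1/7+1/11+1/13+1/17+1/19+1/29+1/31+1/41+1/43+1/59+1/61+⋯ où les
  dénominateurs sont "nombres premiers jumeaux" est convergente ou finie*, Bull. Sci. Math. (2) 43
  (1919), 100–104, 124–128 (JFM 47.0163.01). [cite: BrunTwinPrimes1919] (Original not held; an
  acquisition request is filed. The formalisation follows the textbook route below.)
* A. C. Cojocaru, M. R. Murty, *An Introduction to Sieve Methods and their Applications*, LMS
  Student Texts 66, CUP (2005), doi:10.1017/cbo9780511615993: §5.4, Theorem 5.4.4 (book p. 72)
  "The number of primes `p ≤ x` such that `p + 2` is prime is `≪ x (log log x)²/(log x)²`",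
  Corollary 5.4.5 (Brun's theorem, p. 73), and §6.1 "Brun's pure sieve", (6.1)–(6.5),
  Theorem 6.1.2. [cite: CojocaruMurty2005]

## Mathlib / Literature used

`ZMod.prodEquivPi` (CRT), `Nat.filter_Ico_card_eq_of_periodic`, `Nat.count_eq_card_filter_range`,
`isLittleO_log_rpow_rpow_atTop`, `Real.isLittleO_log_id_atTop`, `Real.summable_one_div_nat_rpow`,
`summable_of_sum_range_le`, `summable_subtype_iff_indicator`; `Literature.BrunPureSieve.*`,
`Literature.NumberTheory.LFunctions.MertensBound.sum_inv_prime_le`, `Literature.NumberTheory.Sieve.log_le_prod_primesBelow_one_sub_inv_inv`.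
-/

open Finset Real

namespace Literature.NumberTheory.Sieve

namespace BrunTwinPrimes

/-! ### Local densities: residues `a mod d` with `d ∣ a (a + 2)` -/

/-- For an odd prime `p`, the congruence `t (t + 2) ≡ 0 (mod p)` has exactly the two solutions
`t ≡ 0` and `t ≡ -2`. [folklore] -/
theorem card_zmod_mul_add_two_eq_zero {p : ℕ} [NeZero p] (hp : p.Prime) (hp2 : p ≠ 2) :
    Fintype.card {t : ZMod p // t * (t + 2) = 0} = 2 := by
  classical
  haveI := Fact.mk hp
  have h2 : (2 : ZMod p) ≠ 0 := by
    intro h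
    have : ((2 : ℕ) : ZMod p) = 0 := by exact_mod_cast h
    rw [ZMod.natCast_eq_zero_iff] at this
    exact hp2 ((Nat.prime_dvd_prime_iff_eq hp Nat.prime_two).mp this)
  rw [Fintype.card_subtype]
  have hset : (Finset.univ.filter fun t : ZMod p => t * (t + 2) = 0) = {0, -2} := by
    ext t
    simp only [Finset.mem_filter, Finset.mem_univ, true_and, Finset.mem_insert,
      Finset.mem_singleton, mul_eq_zero, add_eq_zero_iff_eq_neg]
  rw [hset, Finset.card_pair]
  intro h
  rw [eq_comm, neg_eq_zero] at h
  exact h2 h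

/-- Counting residues through `ZMod`: if `P a ↔ Q (a mod d)`, then
`#{a < d : P a} = #{x : ZMod d | Q x}`. [folklore] -/
theorem card_filter_range_eq_card_subtype {d : ℕ} [NeZero d] (P : ℕ → Prop) [DecidablePred P]
    (Q : ZMod d → Prop) [DecidablePred Q] (hPQ : ∀ a, P a ↔ Q (a : ZMod d)) :
    #{a ∈ range d | P a} = Fintype.card {x : ZMod d // Q x} := by
  rw [Fintype.card_subtype]
  refine Finset.card_nbij' (fun a => (a : ZMod d)) (fun x => x.val) ?_ ?_ ?_ ?_
  · intro a ha
    simp only [Finset.coe_filter, Set.mem_setOf_eq, Finset.mem_range] at ha ⊢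
    exact ⟨Finset.mem_univ _, (hPQ a).mp ha.2⟩
  · intro x hx
    simp only [Finset.coe_filter, Set.mem_setOf_eq, Finset.mem_range] at hx ⊢
    refine ⟨ZMod.val_lt x, ?_⟩
    rw [hPQ, ZMod.natCast_zmod_val]
    exact hx.2
  · intro a ha
    simp only [Finset.coe_filter, Set.mem_setOf_eq, Finset.mem_range] at ha
    exact ZMod.val_natCast_of_lt ha.1
  · intro x _
    exact ZMod.natCast_zmod_val x

/-- **Chinese remainder count.** For a finite set `S` of odd primes and `d = ∏_{p ∈ S} p`, the
number of residues `a mod d` with `p ∣ a (a + 2)` for every `p ∈ S` is `2 ^ #S`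
(`ZMod d ≃ ∏_{p ∈ S} ZMod p` and two admissible classes `0, -2` modulo each `p`). [folklore] -/
theorem card_filter_range_prod_eq_two_pow (S : Finset ℕ) (hS : ∀ p ∈ S, p.Prime ∧ p ≠ 2) :
    #{a ∈ range (∏ p ∈ S, p) | ∀ p ∈ S, p ∣ a * (a + 2)} = 2 ^ #S := by
  classical
  -- index the primes by the subtype `↥S`
  set a : ↥S → ℕ := fun i => (i : ℕ) with ha_def
  have hd : ∏ p ∈ S, p = ∏ i, a i := (Finset.prod_coe_sort S (fun p => p)).symm
  have hcop : Pairwise (Function.onFun Nat.Coprime a) := by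
    intro i j hij
    have hi := hS i i.2
    have hj := hS j j.2
    exact (Nat.coprime_primes hi.1 hj.1).mpr (fun h => hij (Subtype.ext h))
  haveI hne : ∀ i, NeZero (a i) := fun i => ⟨(hS i i.2).1.ne_zero⟩
  haveI : NeZero (∏ i, a i) := ⟨Finset.prod_ne_zero_iff.mpr fun i _ => (hne i).ne⟩
  rw [hd]
  -- the condition read in `ZMod (∏ a i)` through the projections
  set Q : ZMod (∏ i, a i) → Prop := fun x =>
    ∀ i, (ZMod.castHom (Finset.dvd_prod_of_mem a (Finset.mem_univ i)) (ZMod (a i)) x) *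
      ((ZMod.castHom (Finset.dvd_prod_of_mem a (Finset.mem_univ i)) (ZMod (a i)) x) + 2) = 0
    with hQ_def
  have hPQ : ∀ n : ℕ, (∀ p ∈ S, p ∣ n * (n + 2)) ↔ Q (n : ZMod (∏ i, a i)) := by
    intro n
    simp only [hQ_def, map_natCast]
    constructor
    · intro h i
      have := h i i.2
      rw [← ZMod.natCast_eq_zero_iff] at this
      push_cast at this
      exact this
    · intro h p hp
      have := h ⟨p, hp⟩
      rw [← ZMod.natCast_eq_zero_iff]
      push_cast
      exact this
  rw [card_filter_range_eq_card_subtype _ Q hPQ]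
  -- transport along the CRT isomorphism
  have e1 : {x : ZMod (∏ i, a i) // Q x} ≃ {y : (∀ i, ZMod (a i)) // ∀ i, y i * (y i + 2) = 0} :=
    (ZMod.prodEquivPi a hcop).toEquiv.subtypeEquiv (fun x => by
      simp only [hQ_def, RingEquiv.toEquiv_eq_coe, EquivLike.coe_coe, ZMod.prodEquivPi_apply])
  have e2 : {y : (∀ i, ZMod (a i)) // ∀ i, y i * (y i + 2) = 0} ≃
      (∀ i, {t : ZMod (a i) // t * (t + 2) = 0}) :=
    Equiv.subtypePiEquivPi (α := ↥S) (β := fun i => ZMod (a i))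
      (p := fun i (t : ZMod (a i)) => t * (t + 2) = 0)
  rw [Fintype.card_congr (e1.trans e2), Fintype.card_pi]
  have h2 : ∀ i : ↥S, Fintype.card {t : ZMod (a i) // t * (t + 2) = 0} = 2 := fun i =>
    card_zmod_mul_add_two_eq_zero (hS i i.2).1 (hS i i.2).2
  simp only [h2, Finset.prod_const, Finset.card_univ, Fintype.card_coe]

/-! ### Counting a periodic condition on an interval -/

/-- Full periods: a `d`-periodic condition holds on `[1, 1 + q d)` exactly `q · #{a < d : P a}`
times. [folklore] -/
theorem card_filter_Ico_one_add_mul {d : ℕ} (P : ℕ → Prop) [DecidablePred P]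
    (hP : Function.Periodic P d) (q : ℕ) :
    #{n ∈ Ico 1 (1 + q * d) | P n} = q * Nat.count P d := by
  induction q with
  | zero => simp
  | succ q ih =>
    have hsplit : Ico 1 (1 + (q + 1) * d) = Ico 1 (1 + q * d) ∪ Ico (1 + q * d) (1 + q * d + d) := by
      rw [add_mul, one_mul, ← add_assoc]
      exact (Finset.Ico_union_Ico_eq_Ico (by omega) (by omega)).symm
    rw [hsplit, Finset.filter_union, Finset.card_union_of_disjoint, ih,
      Nat.filter_Ico_card_eq_of_periodic _ _ P hP, add_mul, one_mul]
    exact Finset.disjoint_filter_filter (Finset.Ico_disjoint_Ico_consecutive _ _ _)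

/-- A `d`-periodic condition (`d ≥ 1`) holds on `[1, N]` for `N c / d + θ` integers, `|θ| ≤ c`,
where `c = #{a < d : P a}` is the number of admissible residues. [folklore] -/
theorem abs_card_filter_Icc_sub_le {d : ℕ} (hd : 0 < d) (P : ℕ → Prop) [DecidablePred P]
    (hP : Function.Periodic P d) (N : ℕ) :
    |(#{n ∈ Icc 1 N | P n} : ℝ) - N * Nat.count P d / d| ≤ Nat.count P d := by
  set c := Nat.count P d with hc
  set q := N / d with hq
  have hlow : q * c ≤ #{n ∈ Icc 1 N | P n} := by
    rw [← card_filter_Ico_one_add_mul P hP q]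
    refine Finset.card_le_card (Finset.filter_subset_filter _ fun n hn => ?_)
    rw [Finset.mem_Ico] at hn
    rw [Finset.mem_Icc]
    have := Nat.div_mul_le_self N d
    rw [← hq] at this
    omega
  have hupp : #{n ∈ Icc 1 N | P n} ≤ (q + 1) * c := by
    rw [← card_filter_Ico_one_add_mul P hP (q + 1)]
    refine Finset.card_le_card (Finset.filter_subset_filter _ fun n hn => ?_)
    rw [Finset.mem_Icc] at hn
    rw [Finset.mem_Ico]
    have := Nat.lt_div_mul_add (a := N) hd
    have h' : (q + 1) * d = N / d * d + d := by rw [hq]; ring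
    omega
  have hd' : (0 : ℝ) < d := by exact_mod_cast hd
  have hq1 : (q : ℝ) * d ≤ N := by exact_mod_cast Nat.div_mul_le_self N d
  have hq2 : (N : ℝ) < (q + 1) * d := by
    have := Nat.lt_div_mul_add (a := N) hd
    have h' : ((N / d * d + d : ℕ) : ℝ) = ((q : ℝ) + 1) * d := by rw [hq]; push_cast; ring
    rw [← h'] ; exact_mod_cast this
  have hc0 : (0 : ℝ) ≤ c := Nat.cast_nonneg _
  have hlow' : (q : ℝ) * c ≤ #{n ∈ Icc 1 N | P n} := by exact_mod_cast hlow
  have hupp' : (#{n ∈ Icc 1 N | P n} : ℝ) ≤ ((q : ℝ) + 1) * c := by exact_mod_cast hupp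
  have hq1' : (q : ℝ) ≤ N / d := by rw [le_div_iff₀ hd']; exact hq1
  have hq2' : (N : ℝ) / d < q + 1 := by rw [div_lt_iff₀ hd']; exact hq2
  rw [abs_le]
  constructor
  · have : (N : ℝ) * c / d ≤ ((q : ℝ) + 1) * c := by
      rw [mul_div_right_comm]
      exact mul_le_mul_of_nonneg_right hq2'.le hc0
    linarith
  · have : (q : ℝ) * c ≤ (N : ℝ) * c / d := by
      rw [mul_div_right_comm]
      exact mul_le_mul_of_nonneg_right hq1' hc0
    linarith

/-- Periodicity of the twin condition: for `p ∣ d`,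
`p ∣ (n + d)(n + d + 2) ↔ p ∣ n (n + 2)`. [folklore] -/
theorem dvd_add_mul_add_iff {p d : ℕ} (h : p ∣ d) (n : ℕ) :
    p ∣ (n + d) * (n + d + 2) ↔ p ∣ n * (n + 2) := by
  have : (n + d) * (n + d + 2) = d * (2 * n + d + 2) + n * (n + 2) := by ring
  rw [this]
  exact Nat.dvd_add_right (Dvd.dvd.mul_right h _)

/-- **Local densities of the twin-prime sieve** (Cojocaru–Murty §5.4, proof of Thm 5.4.4: "for
each prime `p < z` we distinguish the residue classes `0` and `-2` modulo `p`", `ω(p) = 2`,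
`|R_d| ≤ ω(d)`): for a finite set `S` of odd primes,
`#{1 ≤ n ≤ N : p ∣ n(n+2) ∀ p ∈ S} = N ∏_{p ∈ S} (2/p) + θ` with `|θ| ≤ 2^{#S}`.
[cite: CojocaruMurty2005, §5.4 proof of Theorem 5.4.4] -/
theorem abs_card_filter_twin_sub_le (S : Finset ℕ) (hS : ∀ p ∈ S, p.Prime ∧ p ≠ 2) (N : ℕ) :
    |(#{n ∈ Icc 1 N | ∀ p ∈ S, p ∣ n * (n + 2)} : ℝ) - N * ∏ p ∈ S, (2 / (p : ℝ))| ≤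
      2 ^ #S := by
  set d := ∏ p ∈ S, p with hd_def
  have hd : 0 < d := Finset.prod_pos fun p hp => (hS p hp).1.pos
  have hper : Function.Periodic (fun n => ∀ p ∈ S, p ∣ n * (n + 2)) d := by
    intro n
    simp only [eq_iff_iff]
    refine forall₂_congr fun p hp => ?_
    exact dvd_add_mul_add_iff (Finset.dvd_prod_of_mem _ hp) n
  have hcount : Nat.count (fun n => ∀ p ∈ S, p ∣ n * (n + 2)) d = 2 ^ #S := by
    rw [Nat.count_eq_card_filter_range, hd_def, card_filter_range_prod_eq_two_pow S hS]
  have h := abs_card_filter_Icc_sub_le hd _ hper N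
  rw [hcount] at h
  have hprod : ∏ p ∈ S, (2 / (p : ℝ)) = (2 : ℝ) ^ #S / d := by
    rw [Finset.prod_div_distrib, Finset.prod_const, hd_def, Nat.cast_prod]
  rw [hprod, ← mul_div_assoc]
  push_cast at h
  exact h

/-! ### Brun's pure sieve for the twin-prime problem -/

/-- **Brun's pure sieve for `n (n + 2)`** (Cojocaru–Murty §6.1, (6.5) and Thm 6.1.2 with
`ω(p) = 2`, `|R_d| ≤ ω(d) = 2^{ν(d)}`; Bonferroni truncation at an even level `r`): for a finite
set `P` of odd primes, `N ≥ 0` and even `r`,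
`#{1 ≤ n ≤ N : p ∤ n(n+2) ∀ p ∈ P} ≤ N (∏_{p ∈ P} (1 - 2/p) + ∑_{S ⊆ P, #S = r+1} ∏_{p ∈ S} 2/p)
  + 2^r ∑_{k ≤ r} C(#P, k)`.
[cite: CojocaruMurty2005, §6.1 (6.5) and Theorem 6.1.2] -/
theorem twin_pure_sieve_le (P : Finset ℕ) (hP : ∀ p ∈ P, p.Prime ∧ p ≠ 2) (N : ℕ) {r : ℕ}
    (hr : Even r) :
    (#{n ∈ Icc 1 N | ∀ p ∈ P, ¬p ∣ n * (n + 2)} : ℝ) ≤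
      (N : ℝ) * (∏ p ∈ P, (1 - 2 / (p : ℝ)) + ∑ S ∈ P.powersetCard (r + 1), ∏ p ∈ S, 2 / (p : ℝ))
        + 2 ^ r * ∑ k ∈ range (r + 1), ((#P).choose k : ℝ) := by
  -- Step 1: counting Bonferroni
  have step1 := BrunPureSieve.card_filter_forall_not_le_bonferroniSum (Icc 1 N) P
    (fun p n => p ∣ n * (n + 2)) hr
  -- Step 2: each term `(-1)^k #{n : S} ≤ (-1)^k N ∏ 2/p + 2^r`
  have step2 : ∀ k ∈ range (r + 1), ∀ S ∈ P.powersetCard k,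
      (-1 : ℝ) ^ k * (#{n ∈ Icc 1 N | ∀ p ∈ S, p ∣ n * (n + 2)} : ℝ) ≤
        (-1 : ℝ) ^ k * ((N : ℝ) * ∏ p ∈ S, 2 / (p : ℝ)) + 2 ^ r := by
    intro k hk S hS
    have hSP : S ⊆ P := (Finset.mem_powersetCard.mp hS).1
    have hSk : #S = k := (Finset.mem_powersetCard.mp hS).2
    have habs := abs_card_filter_twin_sub_le S (fun p hp => hP p (hSP hp)) N
    rw [hSk, abs_le] at habs
    obtain ⟨hlo, hhi⟩ := habs
    have hkr : (2 : ℝ) ^ k ≤ 2 ^ r :=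
      pow_le_pow_right₀ (by norm_num) (Nat.lt_succ_iff.mp (Finset.mem_range.mp hk))
    rcases neg_one_pow_eq_or ℝ k with h1 | h1
    · rw [h1]; linarith
    · rw [h1]; linarith
  -- Step 3: sum up
  have step3 : ∑ k ∈ range (r + 1), (-1 : ℝ) ^ k *
      ∑ S ∈ P.powersetCard k, (#{n ∈ Icc 1 N | ∀ p ∈ S, p ∣ n * (n + 2)} : ℝ) ≤
      (N : ℝ) * ∑ k ∈ range (r + 1), (-1 : ℝ) ^ k * ∑ S ∈ P.powersetCard k, ∏ p ∈ S, 2 / (p : ℝ)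
        + 2 ^ r * ∑ k ∈ range (r + 1), ((#P).choose k : ℝ) := by
    calc ∑ k ∈ range (r + 1), (-1 : ℝ) ^ k *
          ∑ S ∈ P.powersetCard k, (#{n ∈ Icc 1 N | ∀ p ∈ S, p ∣ n * (n + 2)} : ℝ)
        = ∑ k ∈ range (r + 1), ∑ S ∈ P.powersetCard k,
            (-1 : ℝ) ^ k * (#{n ∈ Icc 1 N | ∀ p ∈ S, p ∣ n * (n + 2)} : ℝ) := by
          simp_rw [Finset.mul_sum]
      _ ≤ ∑ k ∈ range (r + 1), ∑ S ∈ P.powersetCard k,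
            ((-1 : ℝ) ^ k * ((N : ℝ) * ∏ p ∈ S, 2 / (p : ℝ)) + 2 ^ r) :=
          Finset.sum_le_sum fun k hk => Finset.sum_le_sum fun S hS => step2 k hk S hS
      _ = ∑ k ∈ range (r + 1),
            ((∑ S ∈ P.powersetCard k, (-1 : ℝ) ^ k * ((N : ℝ) * ∏ p ∈ S, 2 / (p : ℝ)))
              + ((#P).choose k : ℝ) * 2 ^ r) := by
          refine Finset.sum_congr rfl fun k _ => ?_
          rw [Finset.sum_add_distrib, Finset.sum_const, nsmul_eq_mul, Finset.card_powersetCard]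
      _ = _ := by
          rw [Finset.sum_add_distrib, Finset.mul_sum, Finset.mul_sum]
          congr 1
          · refine Finset.sum_congr rfl fun k _ => ?_
            rw [Finset.mul_sum, Finset.mul_sum]
            exact Finset.sum_congr rfl fun S _ => by ring
          · exact Finset.sum_congr rfl fun k _ => by ring
  -- Step 4: Bonferroni for the product
  have step4 := BrunPureSieve.bonferroniSum_le_prod_one_sub_add P (fun p => 2 / (p : ℝ))
    (fun p _ => by positivity)
    (fun p hp => by
      have h2 : (2 : ℝ) ≤ p := by exact_mod_cast (hP p hp).1.two_le
      rw [div_le_one (by linarith)]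
      exact h2) hr
  have hN : (0 : ℝ) ≤ N := Nat.cast_nonneg N
  exact step1.trans (step3.trans (add_le_add (mul_le_mul_of_nonneg_left step4 hN) le_rfl))



/-! ### Inputs for the parameter choice -/

/-- The odd primes below `z` are primes different from `2`. [folklore] -/
theorem prime_of_mem_erase_two {z p : ℕ} (hp : p ∈ (Nat.primesBelow z).erase 2) :
    p.Prime ∧ p ≠ 2 := by
  rw [Finset.mem_erase, Nat.mem_primesBelow] at hp
  exact ⟨hp.2.2, hp.1⟩

/-- `#{odd primes < z} + 1 ≤ z` for `z ≥ 1`. [folklore] -/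
theorem card_erase_two_add_one_le {z : ℕ} (hz : 1 ≤ z) :
    #((Nat.primesBelow z).erase 2) + 1 ≤ z := by
  have hsub : (Nat.primesBelow z).erase 2 ⊆ (range z).erase 0 := by
    intro p hp
    rw [Finset.mem_erase, Nat.mem_primesBelow] at hp
    exact Finset.mem_erase.mpr ⟨hp.2.2.ne_zero, Finset.mem_range.mpr hp.2.1⟩
  have := Finset.card_le_card hsub
  rw [Finset.card_erase_of_mem (Finset.mem_range.mpr (by omega)), Finset.card_range] at this
  omega

/-- **Mertens-free upper bound for the sifting product** (from
`Literature.NumberTheory.Sieve.log_le_prod_primesBelow_one_sub_inv_inv`: `log z ≤ ∏_{p < z} (1 - 1/p)⁻¹`, the Euler product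
of `1/n` over `z`-smooth numbers dominating the harmonic sum): for `z ≥ 3`,
`∏_{2 < p < z} (1 - 2/p) ≤ 4 / (log z)²`. [folklore] -/
theorem prod_one_sub_two_div_le {z : ℕ} (hz : 3 ≤ z) :
    ∏ p ∈ (Nat.primesBelow z).erase 2, (1 - 2 / (p : ℝ)) ≤ 4 / Real.log z ^ 2 := by
  have hz' : (3 : ℝ) ≤ z := by exact_mod_cast hz
  have hlog : 0 < Real.log z := Real.log_pos (by linarith)
  set Q := ∏ p ∈ Nat.primesBelow z, (1 - (p : ℝ)⁻¹) with hQ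
  have hQpos : 0 < Q := by
    refine Finset.prod_pos fun p hp => ?_
    have hp1 : (1 : ℝ) < p := by exact_mod_cast (Nat.mem_primesBelow.mp hp).2.one_lt
    have : (p : ℝ)⁻¹ < 1 := inv_lt_one_of_one_lt₀ hp1
    linarith
  have hQle : Q ≤ (Real.log z)⁻¹ := by
    have h := Literature.NumberTheory.Sieve.log_le_prod_primesBelow_one_sub_inv_inv z
    rw [Finset.prod_inv_distrib] at h
    have := inv_anti₀ hlog h
    rwa [inv_inv] at this
  have h2 : 2 ∈ Nat.primesBelow z := Nat.mem_primesBelow.mpr ⟨by omega, Nat.prime_two⟩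
  have hsplit : (1 - (2 : ℝ)⁻¹) * ∏ p ∈ (Nat.primesBelow z).erase 2, (1 - (p : ℝ)⁻¹) = Q := by
    rw [hQ, ← Finset.mul_prod_erase _ _ h2, Nat.cast_ofNat]
  have hP1 : ∏ p ∈ (Nat.primesBelow z).erase 2, (1 - (p : ℝ)⁻¹) ≤ 2 / Real.log z := by
    have : ∏ p ∈ (Nat.primesBelow z).erase 2, (1 - (p : ℝ)⁻¹) = 2 * Q := by
      rw [← hsplit]; ring
    rw [this, div_eq_mul_inv]
    exact mul_le_mul_of_nonneg_left hQle (by norm_num)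
  have hP0 : 0 ≤ ∏ p ∈ (Nat.primesBelow z).erase 2, (1 - (p : ℝ)⁻¹) := by
    refine Finset.prod_nonneg fun p hp => ?_
    have hp1 : (1 : ℝ) < p := by exact_mod_cast (prime_of_mem_erase_two hp).1.one_lt
    have : (p : ℝ)⁻¹ < 1 := inv_lt_one_of_one_lt₀ hp1
    linarith
  calc ∏ p ∈ (Nat.primesBelow z).erase 2, (1 - 2 / (p : ℝ))
      ≤ ∏ p ∈ (Nat.primesBelow z).erase 2, (1 - (p : ℝ)⁻¹) ^ 2 := by
        refine Finset.prod_le_prod (fun p hp => ?_) (fun p hp => ?_)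
        · have hp2 : (2 : ℝ) ≤ p := by exact_mod_cast (prime_of_mem_erase_two hp).1.two_le
          rw [sub_nonneg, div_le_one (by linarith)]
          exact hp2
        · have : (1 - (p : ℝ)⁻¹) ^ 2 = 1 - 2 / p + ((p : ℝ)⁻¹) ^ 2 := by ring
          rw [this]
          linarith [sq_nonneg ((p : ℝ)⁻¹)]
    _ = (∏ p ∈ (Nat.primesBelow z).erase 2, (1 - (p : ℝ)⁻¹)) ^ 2 := Finset.prod_pow _ _ _
    _ ≤ (2 / Real.log z) ^ 2 := pow_le_pow_left₀ hP0 hP1 2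
    _ = 4 / Real.log z ^ 2 := by ring

/-- **Upper Mertens bound for the twin densities** (from `Literature.NumberTheory.LFunctions.MertensBound.sum_inv_prime_le`,
`∑_{p ≤ z} 1/p ≤ log log z + 4`): for `z ≥ 2`, `∑_{2 < p < z} 2/p ≤ 2 (log log z + 4)`. [folklore] -/
theorem sum_two_div_le {z : ℕ} (hz : 2 ≤ z) :
    ∑ p ∈ (Nat.primesBelow z).erase 2, 2 / (p : ℝ) ≤ 2 * (Real.log (Real.log z) + 4) := by
  have hsub : (Nat.primesBelow z).erase 2 ⊆ Nat.primesLE z := by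
    intro p hp
    rw [Finset.mem_erase, Nat.mem_primesBelow] at hp
    exact Nat.mem_primesLE.mpr ⟨hp.2.1.le, hp.2.2⟩
  calc ∑ p ∈ (Nat.primesBelow z).erase 2, 2 / (p : ℝ)
      = 2 * ∑ p ∈ (Nat.primesBelow z).erase 2, 1 / (p : ℝ) := by
        rw [Finset.mul_sum]
        exact Finset.sum_congr rfl fun p _ => by ring
    _ ≤ 2 * ∑ p ∈ Nat.primesLE z, 1 / (p : ℝ) := by
        refine mul_le_mul_of_nonneg_left ?_ (by norm_num)
        exact Finset.sum_le_sum_of_subset_of_nonneg hsub fun p _ _ => by positivity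
    _ ≤ 2 * (Real.log (Real.log z) + 4) :=
        mul_le_mul_of_nonneg_left (Literature.NumberTheory.LFunctions.MertensBound.sum_inv_prime_le z hz) (by norm_num)

/-- `e² ≤ 8`. [folklore] -/
theorem exp_two_le_eight : Real.exp 2 ≤ 8 := by
  have h := Real.exp_one_lt_d9
  have h0 : 0 < Real.exp 1 := Real.exp_pos 1
  have : Real.exp 2 = Real.exp 1 * Real.exp 1 := by rw [← Real.exp_add]; norm_num
  rw [this]
  nlinarith

/-- **Rankin bound for the Bonferroni tail of the twin densities**: for `z ≥ 2` and any `k`,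
`∑_{S ⊆ {2 < p < z}, #S = k} ∏_{p ∈ S} 2/p ≤ exp(-2k + 16 (log log z + 4))`
(`esymm_le_inv_pow_mul_exp` with `λ = 8 ≥ e²`). [folklore] -/
theorem esymm_two_div_le {z : ℕ} (hz : 2 ≤ z) (k : ℕ) :
    ∑ S ∈ ((Nat.primesBelow z).erase 2).powersetCard k, ∏ p ∈ S, 2 / (p : ℝ) ≤
      Real.exp (-(2 * k) + 16 * (Real.log (Real.log z) + 4)) := by
  have h := BrunPureSieve.esymm_le_inv_pow_mul_exp ((Nat.primesBelow z).erase 2)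
    (fun p => 2 / (p : ℝ)) (fun p _ => by positivity) k (lam := 8) (by norm_num)
  refine h.trans ?_
  rw [Real.exp_add]
  refine mul_le_mul ?_ ?_ (Real.exp_pos _).le (Real.exp_pos _).le
  · -- `(8^k)⁻¹ ≤ exp(-2k)`
    rw [Real.exp_neg]
    refine inv_anti₀ (Real.exp_pos _) ?_
    calc Real.exp (2 * k) = Real.exp 2 ^ k := by
          rw [← Real.exp_nat_mul]; ring_nf
      _ ≤ 8 ^ k := pow_le_pow_left₀ (Real.exp_pos 2).le exp_two_le_eight k
  · rw [Real.exp_le_exp]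
    have := sum_two_div_le hz
    linarith

/-- The binomial remainder of the pure sieve: `2^r ∑_{k ≤ r} C(m, k) ≤ (2 z)^r` when
`m + 1 ≤ z`. [folklore] -/
theorem two_pow_mul_sum_choose_le {m z : ℕ} (hm : m + 1 ≤ z) (r : ℕ) :
    (2 : ℝ) ^ r * ∑ k ∈ range (r + 1), (m.choose k : ℝ) ≤ (2 * (z : ℝ)) ^ r := by
  have h1 := BrunPureSieve.sum_range_choose_le_pow m r
  have h2 : ((m : ℝ) + 1) ^ r ≤ (z : ℝ) ^ r :=
    pow_le_pow_left₀ (by positivity) (by exact_mod_cast hm) r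
  rw [mul_pow]
  exact mul_le_mul_of_nonneg_left (h1.trans h2) (by positivity)


/-! ### From the sifted set to twin primes -/

/-- Twin primes `z ≤ p ≤ N` survive sifting `n (n + 2)` by the odd primes below `z`, hence
`π₂(N) ≤ z + #{1 ≤ n ≤ N : p ∤ n(n+2) for all odd primes p < z}` (Cojocaru–Murty, proof of
Thm 5.4.4: "the number of twin primes cannot exceed `π(z) + S(𝒜, 𝒫, z) ≤ z + S(𝒜, 𝒫, z)`").
[cite: CojocaruMurty2005, §5.4 proof of Theorem 5.4.4] -/
theorem twin_count_le_add_card_sifted (N z : ℕ) :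
    #{p ∈ range (N + 1) | p.Prime ∧ (p + 2).Prime} ≤
      z + #{n ∈ Icc 1 N | ∀ p ∈ (Nat.primesBelow z).erase 2, ¬p ∣ n * (n + 2)} := by
  have hsplit : (range (N + 1)).filter (fun p => p.Prime ∧ (p + 2).Prime) ⊆
      range z ∪ (Icc 1 N).filter
        (fun n => ∀ p ∈ (Nat.primesBelow z).erase 2, ¬p ∣ n * (n + 2)) := by
    intro p hp
    rw [Finset.mem_filter, Finset.mem_range] at hp
    obtain ⟨hpN, hpp, hp2⟩ := hp
    rw [Finset.mem_union]
    by_cases hpz : p < z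
    · exact Or.inl (Finset.mem_range.mpr hpz)
    · refine Or.inr (Finset.mem_filter.mpr ⟨?_, ?_⟩)
      · rw [Finset.mem_Icc]; exact ⟨hpp.one_lt.le, by omega⟩
      · intro q hq hdvd
        obtain ⟨hqp, hq2⟩ := prime_of_mem_erase_two hq
        have hqz : q < z := (Nat.mem_primesBelow.mp (Finset.mem_erase.mp hq).2).1
        rcases (Nat.Prime.dvd_mul hqp).mp hdvd with h | h
        · have := (Nat.prime_dvd_prime_iff_eq hqp hpp).mp h; omega
        · have := (Nat.prime_dvd_prime_iff_eq hqp hp2).mp h; omega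
  calc #{p ∈ range (N + 1) | p.Prime ∧ (p + 2).Prime}
      ≤ #(range z ∪ (Icc 1 N).filter
          (fun n => ∀ p ∈ (Nat.primesBelow z).erase 2, ¬p ∣ n * (n + 2))) :=
        Finset.card_le_card hsplit
    _ ≤ #(range z) + #{n ∈ Icc 1 N | ∀ p ∈ (Nat.primesBelow z).erase 2, ¬p ∣ n * (n + 2)} :=
        Finset.card_union_le _ _
    _ = _ := by rw [Finset.card_range]

/-! ### The parameter choice: `log z = log N / (84 log log N)`, `r ≈ 10 log log N` -/

/-- **Explicit core bound.** With `L = log N`, `ℓ = log L ≥ 1`, and the three growth conditions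
`exp(59 ℓ + L/2) ≤ N/L²`, `exp(L/(84 ℓ)) + 1 ≤ N/L²`, `3 ≤ exp(L/(84 ℓ))` (all valid for `N`
large), Brun's pure sieve with `z = ⌈N^{1/(84 ℓ)}⌉`, `r = 2 (⌈5 ℓ⌉ + 15)` and Rankin parameter `8`
gives `π₂(N) ≤ 28227 · N ℓ² / L²` (Cojocaru–Murty Thm 5.4.4 with explicit constants; the printed
proof uses the Eratosthenes–Rankin sieve Thm 5.4.1 with the same choice of `log z`).
[cite: CojocaruMurty2005, Theorem 5.4.4 (proof)] -/
theorem twin_count_le_of_conditions (N : ℕ) {L ℓ : ℝ} (hL : L = Real.log N) (hℓ : ℓ = Real.log L)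
    (h1 : 1 ≤ ℓ) (hR : Real.exp (59 * ℓ + L / 2) ≤ N / L ^ 2)
    (hz1 : Real.exp (L / (84 * ℓ)) + 1 ≤ N / L ^ 2) (hz3 : 3 ≤ Real.exp (L / (84 * ℓ))) :
    (#{p ∈ range (N + 1) | p.Prime ∧ (p + 2).Prime} : ℝ) ≤ 28227 * N * ℓ ^ 2 / L ^ 2 := by
  -- basic positivity
  have hL0 : 0 ≤ L := by rw [hL]; exact Real.log_natCast_nonneg N
  have hL1 : Real.exp 1 ≤ L := by
    have hLpos : 0 < L := by
      rcases hL0.lt_or_eq with h | h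
      · exact h
      · exfalso; rw [hℓ, ← h, Real.log_zero] at h1; linarith
    have := Real.exp_le_exp.mpr (hℓ ▸ h1 : 1 ≤ Real.log L)
    rwa [Real.exp_log hLpos] at this
  have hLgt : 2 < L := lt_of_lt_of_le (by have := Real.exp_one_gt_d9; linarith) hL1
  have hLpos : 0 < L := by linarith
  have hℓpos : 0 < ℓ := by linarith
  have hN0 : (0 : ℝ) < N := by
    have hL2 : 0 < L ^ 2 := by positivity
    have h := lt_of_lt_of_le (by positivity : (0 : ℝ) < Real.exp (L / (84 * ℓ)) + 1) hz1
    by_contra hcon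
    push Not at hcon
    have : (N : ℝ) / L ^ 2 ≤ 0 := div_nonpos_of_nonpos_of_nonneg hcon hL2.le
    linarith
  have hNL : (N : ℝ) / L ^ 2 ≤ N := by
    calc (N : ℝ) / L ^ 2 ≤ N / 1 := div_le_div_of_nonneg_left hN0.le one_pos (by nlinarith)
      _ = N := div_one _
  have hNL' : (N : ℝ) / L ^ 2 ≤ N * ℓ ^ 2 / L ^ 2 := by
    rw [mul_div_right_comm]
    exact le_mul_of_one_le_right (by positivity) (by nlinarith)
  -- the parameters
  set y : ℝ := Real.exp (L / (84 * ℓ)) with hy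
  set z : ℕ := ⌈y⌉₊ with hz
  set P : Finset ℕ := (Nat.primesBelow z).erase 2 with hPdef
  set r : ℕ := 2 * (⌈5 * ℓ⌉₊ + 15) with hr
  have hy0 : 0 < y := Real.exp_pos _
  have hy1 : 1 ≤ y := by linarith
  have hyz : y ≤ z := Nat.le_ceil y
  have hzy : (z : ℝ) ≤ y + 1 := (Nat.ceil_lt_add_one hy0.le).le
  have hz3 : 3 ≤ z := by
    have : (3 : ℝ) ≤ z := hz3.trans hyz
    exact_mod_cast this
  have hz0 : (0 : ℝ) < z := by exact_mod_cast (show 0 < z by omega)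
  have hzN : z ≤ N := by
    have : (z : ℝ) ≤ N := hzy.trans (hz1.trans hNL)
    exact_mod_cast this
  have hlogz : L / (84 * ℓ) ≤ Real.log z := by
    have : Real.log y = L / (84 * ℓ) := Real.log_exp _
    rw [← this]
    exact Real.log_le_log hy0 hyz
  have hlogz0 : 0 < Real.log z := lt_of_lt_of_le (by positivity) hlogz
  have hloglogz : Real.log (Real.log z) ≤ ℓ := by
    rw [hℓ]
    refine Real.log_le_log hlogz0 ?_
    rw [hL]
    exact Real.log_le_log hz0 (by exact_mod_cast hzN)
  have hP : ∀ p ∈ P, p.Prime ∧ p ≠ 2 := fun p hp => prime_of_mem_erase_two hp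
  have hr_even : Even r := even_two_mul _
  have hr_ge : 10 * ℓ + 30 ≤ r := by
    have : (5 * ℓ : ℝ) ≤ ⌈5 * ℓ⌉₊ := Nat.le_ceil _
    rw [hr]; push_cast; linarith
  have hr_le : (r : ℝ) ≤ 10 * ℓ + 32 := by
    have : (⌈5 * ℓ⌉₊ : ℝ) < 5 * ℓ + 1 := Nat.ceil_lt_add_one (by positivity)
    rw [hr]; push_cast; linarith
  -- Step A: reduction to the sifted set
  have hA : (#{p ∈ range (N + 1) | p.Prime ∧ (p + 2).Prime} : ℝ) ≤
      z + #{n ∈ Icc 1 N | ∀ p ∈ P, ¬p ∣ n * (n + 2)} := by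
    exact_mod_cast twin_count_le_add_card_sifted N z
  -- Step B: the pure sieve
  have hB := twin_pure_sieve_le P hP N hr_even
  -- Step C: the main term
  have hW : ∏ p ∈ P, (1 - 2 / (p : ℝ)) ≤ 4 * 7056 * ℓ ^ 2 / L ^ 2 := by
    refine (prod_one_sub_two_div_le hz3).trans ?_
    have h1' : 1 / Real.log z ≤ 84 * ℓ / L := by
      have := one_div_le_one_div_of_le (by positivity) hlogz
      rwa [one_div_div] at this
    have h2' : (1 / Real.log z) ^ 2 ≤ (84 * ℓ / L) ^ 2 :=
      pow_le_pow_left₀ (by positivity) h1' 2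
    calc 4 / Real.log z ^ 2 = 4 * (1 / Real.log z) ^ 2 := by ring
      _ ≤ 4 * (84 * ℓ / L) ^ 2 := by linarith
      _ = 4 * 7056 * ℓ ^ 2 / L ^ 2 := by ring
  -- Step D: the Bonferroni tail
  have hE : ∑ S ∈ P.powersetCard (r + 1), ∏ p ∈ S, 2 / (p : ℝ) ≤ 1 / L ^ 2 := by
    refine (esymm_two_div_le (by omega : 2 ≤ z) (r + 1)).trans ?_
    have : (1 : ℝ) / L ^ 2 = Real.exp (-(2 * ℓ)) := by
      rw [Real.exp_neg, hℓ, show (2 : ℝ) * Real.log L = Real.log L + Real.log L by ring,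
        Real.exp_add, Real.exp_log hLpos, one_div, sq]
    rw [this, Real.exp_le_exp]
    push_cast
    nlinarith
  -- Step E: the binomial remainder
  have hRem : (2 : ℝ) ^ r * ∑ k ∈ range (r + 1), ((#P).choose k : ℝ) ≤ N / L ^ 2 := by
    refine (two_pow_mul_sum_choose_le (card_erase_two_add_one_le (by omega : 1 ≤ z)) r).trans ?_
    refine le_trans ?_ hR
    have h4y : (2 * (z : ℝ)) ≤ 4 * y := by linarith
    have hlog4 : Real.log 4 < 1.4 := by
      have : Real.log 4 = Real.log 2 + Real.log 2 := by
        rw [show (4 : ℝ) = 2 * 2 by norm_num, Real.log_mul (by norm_num) (by norm_num)]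
      rw [this]; have := Real.log_two_lt_d9; linarith
    have hlog4pos : 0 < Real.log 4 := Real.log_pos (by norm_num)
    set a : ℝ := L / (84 * ℓ) with ha
    have ha0 : 0 < a := by positivity
    have hla : ℓ * a = L / 84 := by rw [ha]; field_simp
    have hale : a ≤ L / 84 := by
      rw [ha]
      exact div_le_div_of_nonneg_left hL0 (by norm_num) (by linarith)
    have h4yexp : 4 * y = Real.exp (Real.log 4 + a) := by
      rw [Real.exp_add, Real.exp_log (by norm_num : (0 : ℝ) < 4), hy]
    calc (2 * (z : ℝ)) ^ r ≤ (4 * y) ^ r := pow_le_pow_left₀ (by positivity) h4y r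
      _ = Real.exp (r * (Real.log 4 + a)) := by rw [h4yexp, ← Real.exp_nat_mul]
      _ ≤ Real.exp (59 * ℓ + L / 2) := by
          rw [Real.exp_le_exp]
          have e0 : (r : ℝ) * (Real.log 4 + a) ≤ (10 * ℓ + 32) * (Real.log 4 + a) :=
            mul_le_mul_of_nonneg_right hr_le (by positivity)
          have e1 : (10 * ℓ + 32) * (Real.log 4 + a) ≤ (10 * ℓ + 32) * (1.4 + a) :=
            mul_le_mul_of_nonneg_left (by linarith) (by positivity)
          have e2 : (10 * ℓ + 32) * (1.4 + a) = 14 * ℓ + 44.8 + 10 * (ℓ * a) + 32 * a := by ring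
          linarith
  -- Assembly
  have hsift : (#{n ∈ Icc 1 N | ∀ p ∈ P, ¬p ∣ n * (n + 2)} : ℝ) ≤
      N * (4 * 7056 * ℓ ^ 2 / L ^ 2 + 1 / L ^ 2) + N / L ^ 2 := by
    have := mul_le_mul_of_nonneg_left (add_le_add hW hE) hN0.le
    linarith
  have hzb : (z : ℝ) ≤ N * ℓ ^ 2 / L ^ 2 := hzy.trans (hz1.trans hNL')
  have halg : (N : ℝ) * (4 * 7056 * ℓ ^ 2 / L ^ 2 + 1 / L ^ 2) + N / L ^ 2 =
      28224 * (N * ℓ ^ 2 / L ^ 2) + 2 * (N / L ^ 2) := by ring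
  have halg2 : (28227 : ℝ) * N * ℓ ^ 2 / L ^ 2 = 28227 * (N * ℓ ^ 2 / L ^ 2) := by ring
  rw [halg2]
  linarith

/-! ### The growth conditions hold for large `N` -/

/-- The four growth conditions of `twin_count_le_of_conditions` hold for all large real `x`
(`log log x → ∞`, `(log x)^{61} = o(x^{1/2})`, `log L = o(L)`). [folklore] -/
theorem eventually_conditions :
    ∀ᶠ x : ℝ in Filter.atTop, 1 ≤ Real.log (Real.log x) ∧
      Real.exp (59 * Real.log (Real.log x) + Real.log x / 2) ≤ x / Real.log x ^ 2 ∧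
      Real.exp (Real.log x / (84 * Real.log (Real.log x))) + 1 ≤ x / Real.log x ^ 2 ∧
      3 ≤ Real.exp (Real.log x / (84 * Real.log (Real.log x))) := by
  have e1 : ∀ᶠ x : ℝ in Filter.atTop, 1 ≤ Real.log (Real.log x) :=
    (Real.tendsto_log_atTop.comp Real.tendsto_log_atTop).eventually_ge_atTop 1
  have e2 : ∀ᶠ x : ℝ in Filter.atTop, Real.log x ^ 61 ≤ Real.sqrt x := by
    have h := (isLittleO_log_rpow_rpow_atTop (61 : ℝ) (by norm_num : (0 : ℝ) < 1 / 2)).eventuallyLE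
    filter_upwards [h, Filter.eventually_ge_atTop (1 : ℝ)] with x hx hx1
    have hl : 0 ≤ Real.log x := Real.log_nonneg hx1
    rw [Real.norm_eq_abs, Real.norm_eq_abs, abs_of_nonneg (by positivity),
      abs_of_nonneg (by positivity), ← Real.sqrt_eq_rpow,
      show (61 : ℝ) = ((61 : ℕ) : ℝ) by norm_num, Real.rpow_natCast] at hx
    exact hx
  have e3 : ∀ᶠ x : ℝ in Filter.atTop,
      84 * Real.log 3 * Real.log (Real.log x) ≤ Real.log x := by
    have hlog3 : 0 < Real.log 3 := Real.log_pos (by norm_num)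
    have hc : 0 < 1 / (84 * Real.log 3) := by positivity
    have h := Real.tendsto_log_atTop.eventually (Real.isLittleO_log_id_atTop.def hc)
    filter_upwards [h, Filter.eventually_gt_atTop (1 : ℝ)] with x hx hx1
    have hL : 0 < Real.log x := Real.log_pos hx1
    rw [Real.norm_eq_abs, Real.norm_eq_abs, id, abs_of_pos hL] at hx
    have hx' : Real.log (Real.log x) ≤ 1 / (84 * Real.log 3) * Real.log x :=
      (le_abs_self _).trans hx
    have := mul_le_mul_of_nonneg_left hx' (by positivity : (0 : ℝ) ≤ 84 * Real.log 3)
    calc 84 * Real.log 3 * Real.log (Real.log x)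
        ≤ 84 * Real.log 3 * (1 / (84 * Real.log 3) * Real.log x) := this
      _ = Real.log x := by field_simp
  filter_upwards [e1, e2, e3, Filter.eventually_gt_atTop (1 : ℝ)] with x h1 h2 h3 hx1
  set L := Real.log x with hL
  set ℓ := Real.log L with hℓ
  have hx0 : 0 < x := by linarith
  have hLpos : 0 < L := Real.log_pos hx1
  have hL2 : 2 ≤ L := by
    have := Real.exp_le_exp.mpr h1
    rw [Real.exp_log hLpos] at this
    have := Real.exp_one_gt_d9
    linarith
  have hsqrt : Real.sqrt x * Real.sqrt x = x := Real.mul_self_sqrt hx0.le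
  have hsqrt1 : 1 ≤ Real.sqrt x := Real.one_le_sqrt.mpr hx1.le
  have hexpL2 : Real.exp (L / 2) = Real.sqrt x := by
    rw [Real.sqrt_eq_rpow, Real.rpow_def_of_pos hx0, ← hL]
    ring_nf
  have hL61 : 2 * L ^ 2 ≤ L ^ 61 := by
    have : L ≤ L ^ 59 := le_self_pow₀ (by linarith) (by norm_num)
    nlinarith
  refine ⟨h1, ?_, ?_, ?_⟩
  · -- `exp(59 ℓ + L/2) = L^59 √x ≤ x / L²`
    have hexp : Real.exp (59 * ℓ + L / 2) = L ^ 59 * Real.sqrt x := by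
      rw [Real.exp_add, hexpL2, show (59 : ℝ) * ℓ = ((59 : ℕ) : ℝ) * ℓ by norm_num,
        Real.exp_nat_mul, hℓ, Real.exp_log hLpos]
    rw [hexp, le_div_iff₀ (by positivity)]
    calc L ^ 59 * Real.sqrt x * L ^ 2 = L ^ 61 * Real.sqrt x := by ring
      _ ≤ Real.sqrt x * Real.sqrt x := mul_le_mul_of_nonneg_right h2 (by positivity)
      _ = x := hsqrt
  · -- `exp(L/(84 ℓ)) + 1 ≤ √x + 1 ≤ 2 √x ≤ x / L²`
    have hle : Real.exp (L / (84 * ℓ)) ≤ Real.sqrt x := by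
      rw [← hexpL2, Real.exp_le_exp]
      exact div_le_div_of_nonneg_left hLpos.le (by norm_num) (by linarith)
    rw [le_div_iff₀ (by positivity)]
    calc (Real.exp (L / (84 * ℓ)) + 1) * L ^ 2 ≤ (2 * Real.sqrt x) * L ^ 2 := by
          refine mul_le_mul_of_nonneg_right ?_ (by positivity); linarith
      _ = (2 * L ^ 2) * Real.sqrt x := by ring
      _ ≤ L ^ 61 * Real.sqrt x := mul_le_mul_of_nonneg_right hL61 (by positivity)
      _ ≤ Real.sqrt x * Real.sqrt x := mul_le_mul_of_nonneg_right h2 (by positivity)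
      _ = x := hsqrt
  · -- `3 ≤ exp(L/(84 ℓ))` iff `84 log 3 · ℓ ≤ L`
    have hℓpos : 0 < ℓ := by linarith
    rw [← Real.exp_log (by norm_num : (0 : ℝ) < 3), Real.exp_le_exp,
      le_div_iff₀ (by positivity)]
    linarith

/-- **Theorem 5.4.4 of Cojocaru–Murty** (Brun 1919): the number of primes `p ≤ N` with `p + 2`
prime is `≪ N (log log N)² / (log N)²`; here with the explicit constant `28227` and for all
sufficiently large `N`. [cite: CojocaruMurty2005, Theorem 5.4.4] -/
theorem eventually_twin_count_le :
    ∀ᶠ N : ℕ in Filter.atTop, (#{p ∈ range (N + 1) | p.Prime ∧ (p + 2).Prime} : ℝ) ≤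
      28227 * N * Real.log (Real.log N) ^ 2 / Real.log N ^ 2 := by
  filter_upwards [tendsto_natCast_atTop_atTop.eventually eventually_conditions] with N hN
  exact twin_count_le_of_conditions N rfl rfl hN.1 hN.2.1 hN.2.2.1 hN.2.2.2

/-- The same bound in `O`-notation: `π₂(N) = O(N (log log N)² / (log N)²)`.
[cite: CojocaruMurty2005, Theorem 5.4.4] -/
theorem twin_count_isBigO :
    (fun N : ℕ => (#{p ∈ range (N + 1) | p.Prime ∧ (p + 2).Prime} : ℝ)) =O[Filter.atTop]
      fun N : ℕ => (N : ℝ) * Real.log (Real.log N) ^ 2 / Real.log N ^ 2 := by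
  refine Asymptotics.IsBigO.of_bound 28227 ?_
  filter_upwards [eventually_twin_count_le] with N hN
  rw [Real.norm_eq_abs, Real.norm_eq_abs, abs_of_nonneg (Nat.cast_nonneg _)]
  refine hN.trans ?_
  have : (28227 : ℝ) * N * Real.log (Real.log N) ^ 2 / Real.log N ^ 2 =
      28227 * ((N : ℝ) * Real.log (Real.log N) ^ 2 / Real.log N ^ 2) := by ring
  rw [this]
  exact mul_le_mul_of_nonneg_left (le_abs_self _) (by norm_num)

/-- Theorem 5.4.4 for the tree's twin-prime counting function `Literature.NumberTheory.Sieve.twinPrimeCount`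
(`Literature.NumberTheory.Sieve.SingularSeries`: `π₂(N) = #{p ≤ N : p, p + 2 prime}`, the same
finset count): eventually `π₂(N) ≤ 28227 N (log log N)²/(log N)²`.
[cite: CojocaruMurty2005, Theorem 5.4.4] -/
theorem eventually_twinPrimeCount_le :
    ∀ᶠ N : ℕ in Filter.atTop, (twinPrimeCount N : ℝ) ≤
      28227 * N * Real.log (Real.log N) ^ 2 / Real.log N ^ 2 :=
  eventually_twin_count_le

/-- **Theorem 5.4.4 of Cojocaru–Murty** for `Literature.NumberTheory.Sieve.twinPrimeCount`:
`π₂(N) = O(N (log log N)² / (log N)²)`. [cite: CojocaruMurty2005, Theorem 5.4.4] -/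
theorem twinPrimeCount_isBigO :
    (fun N : ℕ => (twinPrimeCount N : ℝ)) =O[Filter.atTop]
      fun N : ℕ => (N : ℝ) * Real.log (Real.log N) ^ 2 / Real.log N ^ 2 :=
  twin_count_isBigO

/-- In particular the twin primes have density zero among the integers in the strong form
`π₂(N) = o(N / log N)`, i.e. `π₂(N) = o(π(N))` given Chebyshev's bound (Brun 1919: "les nombres
premiers jumeaux ... sont infiniment moins denses que les nombres premiers").
[cite: CojocaruMurty2005, Theorem 5.4.4] -/
theorem twinPrimeCount_isLittleO :
    (fun N : ℕ => (twinPrimeCount N : ℝ)) =o[Filter.atTop] fun N : ℕ => (N : ℝ) / Real.log N := by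
  refine twinPrimeCount_isBigO.trans_isLittleO ?_
  -- `(log L)² = o(L)` along `L = log N → ∞`
  have hlog : (fun N : ℕ => Real.log (Real.log (N : ℝ)) ^ 2) =o[Filter.atTop]
      fun N : ℕ => Real.log (N : ℝ) :=
    (Real.isLittleO_pow_log_id_atTop (n := 2)).comp_tendsto
      (Real.tendsto_log_atTop.comp tendsto_natCast_atTop_atTop)
  have hmain := (Asymptotics.isBigO_refl (fun N : ℕ => (N : ℝ) / Real.log N ^ 2)
    Filter.atTop).mul_isLittleO hlog
  refine hmain.congr (fun N => by ring) (fun N => ?_)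
  rcases eq_or_ne (Real.log (N : ℝ)) 0 with h | h
  · simp [h]
  · rw [div_mul_eq_mul_div, pow_two, mul_div_mul_right _ _ h]

/-- A weaker but handier form: for some `C` and all large `N`, `π₂(N) ≤ C N / (log N)^{3/2}`
(since `(log L)² ≤ 16 L^{1/2}`). [cite: CojocaruMurty2005, Theorem 5.4.4] -/
theorem exists_twin_count_le_div_rpow :
    ∃ C : ℝ, 0 ≤ C ∧ ∃ N₀ : ℕ, ∀ N : ℕ, N₀ ≤ N →
      (#{p ∈ range (N + 1) | p.Prime ∧ (p + 2).Prime} : ℝ) ≤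
        C * N / Real.log N ^ (3 / 2 : ℝ) := by
  have hev : ∀ᶠ N : ℕ in Filter.atTop, 1 ≤ Real.log (Real.log (N : ℝ)) :=
    tendsto_natCast_atTop_atTop.eventually
      ((Real.tendsto_log_atTop.comp Real.tendsto_log_atTop).eventually_ge_atTop 1)
  obtain ⟨N₀, hN₀⟩ := Filter.eventually_atTop.mp (eventually_twin_count_le.and hev)
  refine ⟨28227 * 16, by norm_num, N₀, fun N hN => ?_⟩
  obtain ⟨hb, h1⟩ := hN₀ N hN
  refine hb.trans ?_
  set L := Real.log (N : ℝ) with hL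
  have hLpos : 0 < L := by
    by_contra hcon
    push Not at hcon
    have : Real.log L ≤ 0 := by
      rw [← Real.log_abs]
      rcases eq_or_ne L 0 with h0 | h0
      · rw [h0, abs_zero, Real.log_zero]
      · -- `L = log N ≥ 0`, so `L ≤ 0` forces `L = 0`
        exact absurd (le_antisymm hcon (Real.log_natCast_nonneg N)) h0
    linarith
  have hℓ0 : 0 ≤ Real.log L := by linarith
  -- `(log L)² ≤ 16 L^{1/2}`
  have hlogL : Real.log L ≤ L ^ (1 / 4 : ℝ) / (1 / 4) := Real.log_le_rpow_div hLpos.le (by norm_num)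
  have hsq : Real.log L ^ 2 ≤ 16 * L ^ (1 / 2 : ℝ) := by
    have h4 : L ^ (1 / 4 : ℝ) / (1 / 4) = 4 * L ^ (1 / 4 : ℝ) := by ring
    rw [h4] at hlogL
    have h0 : 0 ≤ L ^ (1 / 4 : ℝ) := Real.rpow_nonneg hLpos.le _
    calc Real.log L ^ 2 ≤ (4 * L ^ (1 / 4 : ℝ)) ^ 2 := pow_le_pow_left₀ hℓ0 hlogL 2
      _ = 16 * (L ^ (1 / 4 : ℝ)) ^ 2 := by ring
      _ = 16 * L ^ (1 / 2 : ℝ) := by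
          rw [← Real.rpow_natCast, ← Real.rpow_mul hLpos.le]; norm_num
  have hsplit : L ^ 2 = L ^ (1 / 2 : ℝ) * L ^ (3 / 2 : ℝ) := by
    rw [← Real.rpow_add hLpos]; norm_num
  have hN0 : (0 : ℝ) ≤ N := Nat.cast_nonneg N
  have h32 : 0 < L ^ (3 / 2 : ℝ) := Real.rpow_pos_of_pos hLpos _
  have h12 : 0 < L ^ (1 / 2 : ℝ) := Real.rpow_pos_of_pos hLpos _
  rw [div_le_div_iff₀ (by positivity) h32, hsplit]
  calc 28227 * (N : ℝ) * Real.log L ^ 2 * L ^ (3 / 2 : ℝ)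
      ≤ 28227 * N * (16 * L ^ (1 / 2 : ℝ)) * L ^ (3 / 2 : ℝ) := by gcongr
    _ = 28227 * 16 * N * (L ^ (1 / 2 : ℝ) * L ^ (3 / 2 : ℝ)) := by ring

/-! ### Brun's theorem: the reciprocals of the twin primes are summable -/

/-- A dyadic block of the twin-prime reciprocal series is at most `π₂(2^{j+1}) / 2^j`. [folklore] -/
theorem sum_Ico_indicator_le (j : ℕ) :
    ∑ n ∈ Ico (2 ^ j) (2 ^ (j + 1)), {p : ℕ | p.Prime ∧ (p + 2).Prime}.indicator
        (fun n : ℕ => (1 : ℝ) / n) n ≤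
      (#{p ∈ range (2 ^ (j + 1) + 1) | p.Prime ∧ (p + 2).Prime} : ℝ) / 2 ^ j := by
  have h2j : (0 : ℝ) < 2 ^ j := by positivity
  have hpt : ∀ n ∈ Ico (2 ^ j) (2 ^ (j + 1)),
      {p : ℕ | p.Prime ∧ (p + 2).Prime}.indicator (fun n : ℕ => (1 : ℝ) / n) n ≤
        if n.Prime ∧ (n + 2).Prime then (1 : ℝ) / 2 ^ j else 0 := by
    intro n hn
    have hn' : 2 ^ j ≤ n := (Finset.mem_Ico.mp hn).1
    simp only [Set.indicator_apply, Set.mem_setOf_eq]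
    split_ifs with h
    · exact one_div_le_one_div_of_le h2j (by exact_mod_cast hn')
    · exact le_rfl
  refine (Finset.sum_le_sum hpt).trans ?_
  rw [← Finset.sum_filter, Finset.sum_const, nsmul_eq_mul, mul_one_div]
  refine div_le_div_of_nonneg_right ?_ h2j.le
  exact_mod_cast Finset.card_le_card (Finset.filter_subset_filter _ fun n hn => by
    rw [Finset.mem_Ico] at hn; rw [Finset.mem_range]; omega)

/-- **Brun's theorem** (Brun 1919; Cojocaru–Murty Cor. 5.4.5): `∑_{p, p+2 prime} 1/p < ∞`, in
indicator form on `ℕ`. Proof: dyadic blocks, `∑_{2^j ≤ p < 2^{j+1}} 1/p ≤ π₂(2^{j+1})/2^j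
≪ (j+1)^{-3/2}` by `exists_twin_count_le_div_rpow`.
[cite: BrunTwinPrimes1919, main theorem; CojocaruMurty2005 Corollary 5.4.5] -/
theorem summable_indicator_one_div_twin :
    Summable ({p : ℕ | p.Prime ∧ (p + 2).Prime}.indicator fun n : ℕ => (1 : ℝ) / n) := by
  set f : ℕ → ℝ := {p : ℕ | p.Prime ∧ (p + 2).Prime}.indicator fun n : ℕ => (1 : ℝ) / n with hf
  have hf0 : ∀ n, 0 ≤ f n := fun n => Set.indicator_nonneg (fun m _ => by positivity) n
  obtain ⟨C, hC0, N₀, hC⟩ := exists_twin_count_le_div_rpow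
  -- the summable majorant of the dyadic blocks
  set K : ℝ := 2 * C / Real.log 2 ^ (3 / 2 : ℝ) with hK
  set b : ℕ → ℝ := fun j => K * (1 / ((j : ℝ) + 1) ^ (3 / 2 : ℝ)) with hb
  have hlog2 : 0 < Real.log 2 := Real.log_pos one_lt_two
  have hK0 : 0 ≤ K := by positivity
  have hb0 : ∀ j, 0 ≤ b j := fun j => by positivity
  have hbsum : Summable b := by
    have h := (Real.summable_one_div_nat_rpow.mpr (by norm_num : (1 : ℝ) < 3 / 2))
    have h' : Summable fun n : ℕ => 1 / ((n : ℝ) + 1) ^ (3 / 2 : ℝ) := by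
      have := (summable_nat_add_iff 1).mpr h
      simpa using this
    exact h'.mul_left K
  -- the threshold in dyadic scale
  set J₀ : ℕ := N₀ + 1 with hJ₀
  have hJ₀N : ∀ j, J₀ ≤ j → N₀ ≤ 2 ^ (j + 1) := fun j hj =>
    (Nat.lt_two_pow_self (n := N₀)).le.trans (Nat.pow_le_pow_right (by norm_num) (by omega))
  -- block bound
  have hblock : ∀ j, J₀ ≤ j → ∑ n ∈ Ico (2 ^ j) (2 ^ (j + 1)), f n ≤ b j := by
    intro j hj
    refine (sum_Ico_indicator_le j).trans ?_
    have hcnt := hC (2 ^ (j + 1)) (hJ₀N j hj)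
    have hlog : Real.log ((2 ^ (j + 1) : ℕ) : ℝ) = ((j : ℝ) + 1) * Real.log 2 := by
      push_cast
      rw [Real.log_pow]; push_cast; ring
    rw [hlog] at hcnt
    have hj1 : (0 : ℝ) < (j : ℝ) + 1 := by positivity
    have hpow : (((j : ℝ) + 1) * Real.log 2) ^ (3 / 2 : ℝ) =
        ((j : ℝ) + 1) ^ (3 / 2 : ℝ) * Real.log 2 ^ (3 / 2 : ℝ) :=
      Real.mul_rpow hj1.le hlog2.le
    rw [hpow] at hcnt
    have h2j : (0 : ℝ) < 2 ^ j := by positivity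
    rw [div_le_iff₀ h2j]
    refine hcnt.trans (le_of_eq ?_)
    rw [hb, hK]
    push_cast
    field_simp
    ring
  -- partial sums up to `2^J`
  have hpartial : ∀ J, J₀ ≤ J → ∑ n ∈ range (2 ^ J), f n ≤
      ∑ n ∈ range (2 ^ J₀), f n + ∑ j ∈ Ico J₀ J, b j := by
    intro J hJ
    induction J, hJ using Nat.le_induction with
    | base => simp
    | succ J hJ ih =>
      have hsplit : ∑ n ∈ range (2 ^ (J + 1)), f n =
          ∑ n ∈ range (2 ^ J), f n + ∑ n ∈ Ico (2 ^ J) (2 ^ (J + 1)), f n := by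
        rw [Finset.range_eq_Ico, Finset.range_eq_Ico,
          Finset.sum_Ico_consecutive _ (Nat.zero_le _) (Nat.pow_le_pow_right (by norm_num) J.le_succ)]
      rw [hsplit, Finset.sum_Ico_succ_top hJ]
      linarith [hblock J hJ]
  -- uniform bound on all partial sums
  refine summable_of_sum_range_le hf0 (c := ∑ n ∈ range (2 ^ J₀), f n + ∑' j, b j) fun n => ?_
  set J := max n J₀ with hJdef
  have hnJ : n ≤ 2 ^ J := (Nat.lt_two_pow_self (n := n)).le.trans
    (Nat.pow_le_pow_right (by norm_num) (le_max_left _ _))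
  calc ∑ i ∈ range n, f i ≤ ∑ i ∈ range (2 ^ J), f i :=
        Finset.sum_le_sum_of_subset_of_nonneg (Finset.range_subset_range.mpr hnJ) fun i _ _ => hf0 i
    _ ≤ ∑ n ∈ range (2 ^ J₀), f n + ∑ j ∈ Ico J₀ J, b j := hpartial J (le_max_right _ _)
    _ ≤ ∑ n ∈ range (2 ^ J₀), f n + ∑' j, b j := by
        have := hbsum.sum_le_tsum (Ico J₀ J) (fun j _ => hb0 j)
        linarith

/-- **Brun's theorem** (Brun 1919; Cojocaru–Murty Cor. 5.4.5), subtype form: the series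
`∑ 1/p` over the primes `p` with `p + 2` prime converges.
[cite: BrunTwinPrimes1919, main theorem; CojocaruMurty2005 Corollary 5.4.5] -/
theorem summable_one_div_twin_prime :
    Summable fun p : {p : ℕ // p.Prime ∧ (p + 2).Prime} => (1 : ℝ) / (p : ℕ) :=
  (summable_subtype_iff_indicator (s := {p : ℕ | p.Prime ∧ (p + 2).Prime})
    (f := fun n : ℕ => (1 : ℝ) / n)).mpr summable_indicator_one_div_twin

end BrunTwinPrimes

end Literature.NumberTheory.Sieve
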